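import Mathlib.Analysis.InnerProductSpace.PiL2
import Literature.MathematicalPhysics.StatisticalMechanics.BarlowStacking
import HarnessLib

/-!
# Barlow stackings with arbitrary layer heights (relaxed interlayer spacings)

Companion of `BarlowStacking.lean` (equal spacing `x₃ = k h`). A physical close-packed POLYTYPE
relaxes its interlayer spacings: the spacing between layers `k` and `k + 1` depends on the local
stacking word (Pártay–Ortner–Bartók–Pickard–Csányi 2017, §1 and Appendix A: `ABA`-hexagonal and
`ABC`-cubic environments have different equilibrium spacings), while each layer stays an ideal
triangular layer in one of the three lateral positions `A/B/C` (Hales, *Dense sphere packings*,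
§1.3; Conway–Sloane Ch. 1 §1.3). This file provides the carrier for such stackings: the same
triangular layers and letters as `barlowStacking a h s`, but in the planes `x₃ = H k` for an
arbitrary height function `H : ℤ → ℝ`.

## Main definitions

* `barlowPosH a H s k i j` — the point `i u + j v + (haggLabel s k) w + (H k) e₃`;
* `barlowStackingH a H s : Set (EuclideanSpace ℝ (Fin 3))` — the union of the layers.

## Main results (all proved, [folklore])

* `barlowPosH_apply_zero/one/two` — coordinates (`x₃ = H k`);
* `barlowPosH_linear`, `barlowStackingH_linear` — for `H k = k h` this is `barlowStacking a h s`;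
* `barlowPosH_eq_of_haggLabel_eq` — changing the label by `3 q` is an in-layer translation;
* `sub_le_of_gap_le` — heights with gaps `≥ g` satisfy `(k' − k) g ≤ H k' − H k` (`k ≤ k'`);
* `le_dist_barlowPosH`, `le_dist_of_mem_barlowStackingH` — uniform discreteness `min a g` when
  the gaps of `H` are `≥ g ≥ 0` and `a ≥ 0`.

Not here: which height sequences are equilibria (route-specific), covering radius.

## References

* T. C. Hales, *Dense Sphere Packings: A Blueprint for Formal Proofs*, LMS Lecture Notes 400,
  CUP 2012, §1.3 (hexagonal layers, labels `A, B, C`).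
* J. H. Conway, N. J. A. Sloane, *Sphere Packings, Lattices and Groups*, 3rd ed., Springer 1999,
  Ch. 1 §1.3 (Barlow packings).
* L. B. Pártay, C. Ortner, A. P. Bartók, C. J. Pickard, G. Csányi, *Polytypism in the ground state
  structure of the Lennard-Jonesium*, PCCP 19 (2017), §1, Appendix A (relaxed spacings).
-/

noncomputable section

namespace Literature.MathematicalPhysics.StatisticalMechanics

section Heights

variable (a : ℝ) (H : ℤ → ℝ) (s : ℤ → ℤ)

/-- The point `(i, j)` of layer `k` of the Barlow stacking with letters coded by `s` and layer
HEIGHTS `H`: `i u + j v + (haggLabel s k) w + (H k) e₃` (Hales §1.3 layers, at relaxed heights as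
in Pártay et al. 2017, App. A). [cite: HalesDSP2012, §1.3] -/
def barlowPosH (k i j : ℤ) : EuclideanSpace ℝ (Fin 3) :=
  (i : ℝ) • triangularVec₁ a + (j : ℝ) • triangularVec₂ a +
    (haggLabel s k : ℝ) • barlowOffset a + layerNormal (H k)

/-- **The Barlow stacking with layer heights `H`**: triangular layers of spacing `a` in the planes
`x₃ = H k`, layer `k` in lateral position `haggLabel s k mod 3` (`A/B/C`). For `H k = k h` this
is `barlowStacking a h s` (`barlowStackingH_linear`). Intended for `IsHaggSeq s`, `0 < a` and a
strictly increasing `H` with gaps bounded away from `0`; the definition needs no hypothesis.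
[cite: ConwaySloane1999, Ch. 1 §1.3] -/
def barlowStackingH : Set (EuclideanSpace ℝ (Fin 3)) :=
  {x | ∃ k i j : ℤ, x = barlowPosH a H s k i j}

variable {a H s}

/-- Membership in the stacking. [folklore] -/
theorem mem_barlowStackingH_iff {x : EuclideanSpace ℝ (Fin 3)} :
    x ∈ barlowStackingH a H s ↔ ∃ k i j : ℤ, x = barlowPosH a H s k i j := Iff.rfl

/-- Lattice points are in the stacking. [folklore] -/
theorem barlowPosH_mem (k i j : ℤ) : barlowPosH a H s k i j ∈ barlowStackingH a H s :=
  ⟨k, i, j, rfl⟩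

variable (a H s)

/-- First coordinate of `barlowPosH`. [folklore] -/
@[simp] theorem barlowPosH_apply_zero (k i j : ℤ) :
    barlowPosH a H s k i j 0 = a * (i + j / 2 + haggLabel s k / 2) := by
  simp [barlowPosH, triangularVec₁, triangularVec₂, barlowOffset, layerNormal]; ring

/-- Second coordinate of `barlowPosH`. [folklore] -/
@[simp] theorem barlowPosH_apply_one (k i j : ℤ) :
    barlowPosH a H s k i j 1 = a * √3 / 2 * (j + haggLabel s k / 3) := by
  simp [barlowPosH, triangularVec₁, triangularVec₂, barlowOffset, layerNormal]; ring

/-- **Layer `k` lies in the plane `x₃ = H k`.** [folklore] -/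
@[simp] theorem barlowPosH_apply_two (k i j : ℤ) : barlowPosH a H s k i j 2 = H k := by
  simp [barlowPosH, triangularVec₁, triangularVec₂, barlowOffset, layerNormal]

/-- Equal spacings: `barlowPosH` with `H k = k h` is `barlowPos`. [folklore] -/
theorem barlowPosH_linear (h : ℝ) (k i j : ℤ) :
    barlowPosH a (fun k : ℤ => (k : ℝ) * h) s k i j = barlowPos a h s k i j := by
  ext l
  fin_cases l <;> simp [barlowPos_apply_zero, barlowPos_apply_one, barlowPos_apply_two]

/-- Equal spacings: `barlowStackingH` with `H k = k h` is `barlowStacking a h s`. [folklore] -/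
theorem barlowStackingH_linear (h : ℝ) :
    barlowStackingH a (fun k : ℤ => (k : ℝ) * h) s = barlowStacking a h s := by
  ext x
  simp only [mem_barlowStackingH_iff, mem_barlowStacking_iff, barlowPosH_linear]

/-- Changing the label by `3 q` is the in-layer translation by `q (u + v)`, up to the height
difference. [folklore] -/
theorem barlowPosH_eq_of_haggLabel_eq {H' : ℤ → ℝ} {s' : ℤ → ℤ} {k k' q : ℤ} (i j : ℤ)
    (hL : haggLabel s' k' = haggLabel s k + 3 * q) :
    barlowPosH a H' s' k' i j =
      barlowPosH a H s k (i + q) (j + q) + layerNormal (H' k' - H k) := by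
  ext l
  fin_cases l <;> simp [hL, layerNormal, -mul_eq_mul_left_iff] <;> ring

/-! ### Distances -/

/-- Squared distance of two points of the stacking in coordinates. [folklore] -/
theorem dist_barlowPosH_sq (k i j k' i' j' : ℤ) :
    dist (barlowPosH a H s k i j) (barlowPosH a H s k' i' j') ^ 2 =
      (a * ((i - i') + (j - j') / 2 + (haggLabel s k - haggLabel s k') / 2)) ^ 2 +
      (a * √3 / 2 * ((j - j') + (haggLabel s k - haggLabel s k') / 3)) ^ 2 +
      (H k - H k') ^ 2 := by
  rw [EuclideanSpace.dist_sq_eq, Fin.sum_univ_three, Real.dist_eq, Real.dist_eq, Real.dist_eq,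
    sq_abs, sq_abs, sq_abs, barlowPosH_apply_zero, barlowPosH_apply_zero, barlowPosH_apply_one,
    barlowPosH_apply_one, barlowPosH_apply_two, barlowPosH_apply_two]
  ring

/-- **In-layer distances**: two distinct points of the same layer are at distance `≥ a`.
[folklore] -/
theorem le_dist_barlowPosH_of_ne (ha : 0 ≤ a) {k i j i' j' : ℤ} (hne : (i, j) ≠ (i', j')) :
    a ≤ dist (barlowPosH a H s k i j) (barlowPosH a H s k i' j') := by
  have hsq : dist (barlowPosH a H s k i j) (barlowPosH a H s k i' j') ^ 2 =
      a ^ 2 * ((i - i') ^ 2 + (i - i') * (j - j') + (j - j') ^ 2 : ℤ) := by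
    rw [dist_barlowPosH_sq]
    have h3 : (√3 : ℝ) ^ 2 = 3 := Real.sq_sqrt (by norm_num)
    push_cast
    linear_combination (a ^ 2 * (j - j') ^ 2 / 4) * h3
  have hform : (1 : ℝ) ≤ ((i - i') ^ 2 + (i - i') * (j - j') + (j - j') ^ 2 : ℤ) := by
    exact_mod_cast one_le_sq_add_mul_add_sq (p := i - i') (q := j - j')
      (by simpa [Prod.ext_iff, sub_eq_zero] using hne)
  have h2 : a ^ 2 ≤ dist (barlowPosH a H s k i j) (barlowPosH a H s k i' j') ^ 2 :=
    calc a ^ 2 = a ^ 2 * 1 := by ring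
      _ ≤ _ := mul_le_mul_of_nonneg_left hform (sq_nonneg a)
      _ = _ := hsq.symm
  exact (pow_le_pow_iff_left₀ ha dist_nonneg two_ne_zero).1 h2

/-- Heights with gaps `≥ g` grow at least linearly: `(k' − k) g ≤ H k' − H k` for `k ≤ k'`.
[folklore] -/
theorem sub_le_of_gap_le {g : ℝ} (hgap : ∀ k : ℤ, g ≤ H (k + 1) - H k) {k k' : ℤ} (hkk' : k ≤ k') :
    ((k' : ℝ) - k) * g ≤ H k' - H k := by
  obtain ⟨n, rfl⟩ : ∃ n : ℕ, k' = k + n := ⟨(k' - k).toNat, by omega⟩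
  induction n with
  | zero => simp
  | succ n ih =>
    have h1 := ih (by omega)
    have h2 := hgap (k + n)
    push_cast at h1 ⊢
    rw [show (k : ℤ) + ((n : ℤ) + 1) = k + n + 1 by ring]
    nlinarith

/-- **Interlayer distances**: points of different layers are at distance `≥ g` when the gaps of
`H` are `≥ g ≥ 0`. [folklore] -/
theorem le_dist_barlowPosH_of_layer_ne {g : ℝ} (hg : 0 ≤ g) (hgap : ∀ k : ℤ, g ≤ H (k + 1) - H k)
    {k k' : ℤ} (hk : k ≠ k') (i j i' j' : ℤ) :
    g ≤ dist (barlowPosH a H s k i j) (barlowPosH a H s k' i' j') := by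
  refine le_trans ?_ (PiLp.dist_apply_le (barlowPosH a H s k i j) (barlowPosH a H s k' i' j') 2)
  rw [barlowPosH_apply_two, barlowPosH_apply_two, Real.dist_eq]
  rcases lt_or_gt_of_ne hk with hlt | hlt
  · have h1 := sub_le_of_gap_le H hgap hlt.le
    have h2 : (1 : ℝ) ≤ (k' : ℝ) - k := by
      have : k + 1 ≤ k' := hlt
      have : ((k : ℝ)) + 1 ≤ k' := by exact_mod_cast this
      linarith
    rw [abs_sub_comm, abs_of_nonneg (by nlinarith)]
    nlinarith
  · have h1 := sub_le_of_gap_le H hgap hlt.le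
    have h2 : (1 : ℝ) ≤ (k : ℝ) - k' := by
      have : k' + 1 ≤ k := hlt
      have : ((k' : ℝ)) + 1 ≤ k := by exact_mod_cast this
      linarith
    rw [abs_of_nonneg (by nlinarith)]
    nlinarith

/-- **Uniform discreteness**: distinct points are at distance `≥ min a g`. [folklore] -/
theorem le_dist_barlowPosH (ha : 0 ≤ a) {g : ℝ} (hg : 0 ≤ g) (hgap : ∀ k : ℤ, g ≤ H (k + 1) - H k)
    {k i j k' i' j' : ℤ} (hne : (k, i, j) ≠ (k', i', j')) :
    min a g ≤ dist (barlowPosH a H s k i j) (barlowPosH a H s k' i' j') := by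
  by_cases hk : k = k'
  · subst hk
    have : (i, j) ≠ (i', j') := by rintro h0; apply hne; simp_all
    exact (min_le_left _ _).trans (le_dist_barlowPosH_of_ne a H s ha this)
  · exact (min_le_right _ _).trans (le_dist_barlowPosH_of_layer_ne a H s hg hgap hk i j i' j')

/-- **Uniform discreteness of the stacking** as a statement about the point set. [folklore] -/
theorem le_dist_of_mem_barlowStackingH (ha : 0 ≤ a) {g : ℝ} (hg : 0 ≤ g)
    (hgap : ∀ k : ℤ, g ≤ H (k + 1) - H k) {x y : EuclideanSpace ℝ (Fin 3)}
    (hx : x ∈ barlowStackingH a H s) (hy : y ∈ barlowStackingH a H s) (hxy : x ≠ y) :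
    min a g ≤ dist x y := by
  obtain ⟨k, i, j, rfl⟩ := hx
  obtain ⟨k', i', j', rfl⟩ := hy
  refine le_dist_barlowPosH a H s ha hg hgap ?_
  rintro heq
  simp only [Prod.mk.injEq] at heq
  obtain ⟨rfl, rfl, rfl⟩ := heq
  exact hxy rfl

end Heights

end Literature.MathematicalPhysics.StatisticalMechanics

end
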